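import Mathlib
import Summits.NavierStokesRegularity.NavierStokesRegularity.Theorems.ScenarioCensusPeriodicSlabDecayMean
import HarnessLib

/-!
# Census row S7 (c): the weighted dyadic energy inequality under radial decay

Support file for the scenario census of `NavierStokesRegularity` (cell `pub/ns-census`, block S,
row S7 = Bang–Gui–Wang–Xie, J. Fluid Mech. 1005 (2025) A6 = arXiv:2205.13259, Thm 1.4 (c)). The
printed §5 Step 3 bounds every cut-off term of the energy identity and arrives at
`Y(R) ≤ C₁ R‖u^r‖_{L^∞(𝒪_R)} + C₂ R^{1/2} Y'(R)^{1/2}`: the ONLY term that needs the decay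
`r u^r → 0` is the cubic one, (4-22); the pressure term is of Saint-Venant size through the
corrector. Here, on the dyadic annulus `{r ≤ ρ < 2r}` of one period `S = zSlab L 0` with
`φ = cylCutoff r (2r)`, for `r ≥ 1`, `λ > 0`, assuming `|⟪x_h, U x⟫| ≤ ε ≤ 1` for `ρ(x) ≥ r`:

* `decay_dyadic_weighted_estimate` —
  `∫_S φ|DU|² ≤ (16 C M² L + 64 C K₃ L²) ε + a λ r + c (∫_S χ|DU|²)/(λ r)` with explicit `a, c`
  depending only on `sup ‖U‖`, `L` and the cut-off constant `C` of `exists_corrField_bounds`;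
  the pressure term is split along `u^r = (u^r − ū^r) + ū^r` (foot-point splitting of rows
  S6/S7(a)(b) for the mean-free part, `corrector_pressure_bound` for the mean part).

No summit statement and no census row is proved in this file.

## References

* J. Bang, C. Gui, Y. Wang, C. Xie, arXiv:2205.13259, §5 Step 3, (4-21)–(4-37).
  [BangGuiWangXie2025]
-/

-- the summit and its single problem share the name (D-0017 nested layout)
set_option linter.dupNamespace false

noncomputable section

open MeasureTheory Set Function Filter InnerProductSpace
open scoped Topology ENNReal NNReal RealInnerProductSpace Laplacian ContDiff

namespace Summit.NavierStokesRegularity.NavierStokesRegularity.Theorems.ScenarioCensus.PeriodicSlab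

open Literature.Analysis Literature.Analysis.FluidPDE
open Summit.NavierStokesRegularity.NavierStokesRegularity.Theorems.ScenarioCensus.HelicalSlab

/-- **The weighted dyadic energy inequality under radial decay** (Bang–Gui–Wang–Xie, §5 Step 3,
on the dyadic annulus `{r ≤ ρ < 2r}`). Let `(U, P)` be a smooth steady solution at unit
viscosity (`IsLerayProfile 1 0 U P`, `U, P ∈ C^∞`), both axially `L`-periodic (`L > 0`), with
`‖U‖ ≤ M`, `‖DU‖ ≤ K₁`, `‖DP‖ ≤ K₃`, `|DU|² ≤ B`; let `C` be the constant of
`exists_corrField_bounds` for the radius `r ≥ 1`. If `|⟪x_h, U x⟫| ≤ ε` for `ρ(x) ≥ r` with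
`0 < ε ≤ 1`, then for every `λ > 0`, with `φ = cylCutoff r (2r)`, `χ = 𝟙{r ≤ ρ < 2r}`,
`S = zSlab L 0`:
`∫_S φ|DU|² ≤ (16 C M² L + 64 C K₃ L²) ε`
`  + (96 C M L + 48 C L (3M + π) + 16 C L M (π + M)) λ r`
`  + (3 C M + (3/2) C (3M + π) + (1/2) C M (π + M)) (∫_S χ|DU|²)/(λ r)`. -/
theorem decay_dyadic_weighted_estimate {L M K₁ K₃ B C r lam ε : ℝ} (hL : 0 < L)
    {U : EuclideanSpace ℝ (Fin 3) → EuclideanSpace ℝ (Fin 3)} {P : EuclideanSpace ℝ (Fin 3) → ℝ}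
    (h : IsLerayProfile 1 0 U P) (hU : ContDiff ℝ (⊤ : ℕ∞) U) (hP : ContDiff ℝ (⊤ : ℕ∞) P)
    (hUper : IsAxiallyPeriodic L U) (hPper : IsAxiallyPeriodic L P)
    (hM : ∀ x, ‖U x‖ ≤ M) (hK₁ : ∀ x, ‖fderiv ℝ U x‖ ≤ K₁) (hK₃ : ∀ x, ‖fderiv ℝ P x‖ ≤ K₃)
    (hB : ∀ x, frobeniusNormSq (fderiv ℝ U x) ≤ B) (hC0 : 0 ≤ C)
    (ha : ∀ x, |dyCoeff r x| ≤
      C / r ^ 2 * {x | r ≤ cylRadius x ∧ cylRadius x < 2 * r}.indicator (fun _ => (1 : ℝ)) x)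
    (hW : ∀ x, ‖corrField r x‖ ≤
      C / r * {x | r ≤ cylRadius x ∧ cylRadius x < 2 * r}.indicator (fun _ => (1 : ℝ)) x)
    (hDW : ∀ x, ‖fderiv ℝ (corrField r) x‖ ≤
      C / r ^ 2 * {x | r ≤ cylRadius x ∧ cylRadius x < 2 * r}.indicator (fun _ => (1 : ℝ)) x)
    (hr : 1 ≤ r) (hlam : 0 < lam) (hε : 0 < ε) (hε1 : ε ≤ 1)
    (hdec : ∀ x, r ≤ cylRadius x → |⟪horizPart x, U x⟫| ≤ ε) :
    ∫ x in zSlab L 0, cylCutoff r (2 * r) x * frobeniusNormSq (fderiv ℝ U x) ≤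
      (16 * C * M ^ 2 * L + 64 * C * K₃ * L ^ 2) * ε +
        (96 * C * M * L + 48 * C * L * (3 * M + Real.pi) + 16 * C * L * M * (Real.pi + M)) * lam * r +
        (3 * C * M + 3 / 2 * C * (3 * M + Real.pi) + 1 / 2 * C * M * (Real.pi + M)) *
          (∫ x in zSlab L 0,
            {x | r ≤ cylRadius x ∧ cylRadius x < 2 * r}.indicator (fun _ => (1 : ℝ)) x *
              frobeniusNormSq (fderiv ℝ U x)) / (lam * r) := by
  set b := EuclideanSpace.basisFun (Fin 3) ℝ with hb
  set S : Set (EuclideanSpace ℝ (Fin 3)) := zSlab L 0 with hS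
  set F : EuclideanSpace ℝ (Fin 3) → ℝ := fun x => frobeniusNormSq (fderiv ℝ U x) with hF
  set ur : EuclideanSpace ℝ (Fin 3) → ℝ := fun x => ⟪horizPart x, U x⟫ with hur
  have hr0 : 0 < r := by linarith
  have hr2 : r < 2 * r := by linarith
  have hU1 : ContDiff ℝ 1 U := contDiff_infty.1 hU 1
  have hUc : Continuous U := hU1.continuous
  have hPc : Continuous P := hP.continuous
  have hPd : Differentiable ℝ P := (contDiff_infty.1 hP 1).differentiable one_ne_zero
  have hDUc : Continuous (fderiv ℝ U) := hU1.continuous_fderiv one_ne_zero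
  have hFc : Continuous F := continuous_frobeniusNormSq_fderiv hU1 one_ne_zero
  have hurc : Continuous ur := horizPart.continuous.inner hUc
  have hF0 : ∀ x, 0 ≤ F x := fun x => frobeniusNormSq_nonneg _
  have hM0 : 0 ≤ M := (norm_nonneg _).trans (hM 0)
  have hK₃0 : 0 ≤ K₃ := (norm_nonneg _).trans (hK₃ 0)
  have hdi : ∀ x i, ‖fderiv ℝ U x (b i)‖ ^ 2 ≤ F x := fun x i => norm_apply_sq_le_frobeniusNormSq b _ i
  -- the cut-off and the annulus
  set φ : EuclideanSpace ℝ (Fin 3) → ℝ := cylCutoff r (2 * r) with hφ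
  have hφ2 : ContDiff ℝ 2 φ := contDiff_cylCutoff r (2 * r)
  have hφ1 : ContDiff ℝ 1 φ := contDiff_cylCutoff r (2 * r)
  have hDφc : Continuous (fderiv ℝ φ) := hφ1.continuous_fderiv one_ne_zero
  have hφnn : ∀ x, 0 ≤ φ x := cylCutoff_nonneg r (2 * r)
  have hφzero : ∀ x, 2 * r ≤ cylRadius x → φ x = 0 := fun x hx => cylCutoff_eq_zero hr0.le hr2 hx
  have hφper : IsAxiallyPeriodic L φ := isAxiallyPeriodic_cylCutoff L r (2 * r)
  set a : EuclideanSpace ℝ (Fin 3) → ℝ := dyCoeff r with hadef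
  have hDφa : ∀ x v, fderiv ℝ φ x v = a x * ⟪horizPart x, v⟫ := fun x v => fderiv_cylCutoff_two_mul r x v
  have hac : Continuous a := (contDiff_dyCoeff r (n := 0)).continuous
  have haz : ∀ (x : EuclideanSpace ℝ (Fin 3)) (t : ℝ), a (x + t • eZ) = a x := dyCoeff_add_smul_eZ r
  set A : Set (EuclideanSpace ℝ (Fin 3)) := {x | r ≤ cylRadius x ∧ cylRadius x < 2 * r} with hA
  have hAm : MeasurableSet A :=
    (isClosed_le continuous_const continuous_cylRadius).measurableSet.inter
      (isOpen_lt continuous_cylRadius continuous_const).measurableSet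
  set χ : EuclideanSpace ℝ (Fin 3) → ℝ := A.indicator fun _ => (1 : ℝ) with hχ
  have hχm : Measurable χ := measurable_const.indicator hAm
  have hχnn : ∀ x, 0 ≤ χ x := fun x => Set.indicator_nonneg (fun _ _ => zero_le_one) x
  have hχle : ∀ x, χ x ≤ 1 := fun x => Set.indicator_le_self' (fun _ _ => zero_le_one) x
  have hχzero : ∀ x, 2 * r ≤ cylRadius x → χ x = 0 := fun x hx => by
    simp only [hχ, Set.indicator_apply, hA, mem_setOf_eq]
    rw [if_neg]; exact fun h' => absurd h'.2 (not_lt.2 hx)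
  have ha0 : ∀ x, 2 * r ≤ cylRadius x → a x = 0 := fun x hx => by
    have h1 := ha x
    rw [hχzero x hx, mul_zero] at h1
    exact abs_eq_zero.1 (le_antisymm h1 (abs_nonneg _))
  -- `χ |u^r| ≤ χ ε` and `|∂ᵢφ| ≤ (2C/r) χ`
  have hχur : ∀ x, χ x * |ur x| ≤ χ x * ε := by
    intro x
    by_cases hx : x ∈ A
    · exact mul_le_mul_of_nonneg_left (hdec x hx.1) (hχnn x)
    · have : χ x = 0 := by simp [hχ, hx]
      rw [this, zero_mul, zero_mul]
  have hDφi : ∀ x i, |fderiv ℝ φ x (b i)| ≤ 2 * C / r * χ x := by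
    intro x i
    rw [hDφa x (b i), abs_mul]
    by_cases hx : x ∈ A
    · have hχ1 : χ x = 1 := by simp [hχ, hx]
      have h1 := ha x
      rw [hχ1, mul_one] at h1 ⊢
      have h2 : |⟪horizPart x, b i⟫| ≤ 2 * r := by
        calc |⟪horizPart x, b i⟫| ≤ ‖horizPart x‖ * ‖b i‖ := abs_real_inner_le_norm _ _
          _ ≤ 2 * r := by rw [b.orthonormal.1 i, mul_one, norm_horizPart]; exact hx.2.le
      calc |a x| * |⟪horizPart x, b i⟫| ≤ C / r ^ 2 * (2 * r) := mul_le_mul h1 h2 (abs_nonneg _) (by positivity)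
        _ = 2 * C / r := by field_simp
    · have hχ0 : χ x = 0 := by simp [hχ, hx]
      have h1 := ha x
      rw [hχ0, mul_zero] at h1 ⊢
      rw [abs_eq_zero.1 (le_antisymm h1 (abs_nonneg _)), abs_zero, zero_mul]
  -- the identity per period
  have hid := steady_window_identity hL h hU hP hUper hPper hφ2 hφper hφnn hφzero
  -- the integrals
  set Iφ : ℝ := ∫ x in S, φ x * F x with hIφ
  set D : ℝ := ∫ x in S, χ x * F x with hD
  set V : ℝ := ∫ x in S, χ x with hVdef
  have hχ_int : IntegrableOn χ S volume :=
    integrableOn_zSlab_of_bound hL hχm.aestronglyMeasurable (ρ := 2 * r) hχzero (B := 1)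
      fun x _ => by rw [Real.norm_eq_abs, abs_of_nonneg (hχnn x)]; exact hχle x
  have hB0 : 0 ≤ B := (hF0 0).trans (hB 0)
  have hD_int : IntegrableOn (fun x => χ x * F x) S volume := by
    refine integrableOn_zSlab_of_bound hL ((hχm.mul hFc.measurable).aestronglyMeasurable)
      (ρ := 2 * r) (fun x hx => by rw [hχzero x hx, zero_mul]) (B := B) fun x _ => ?_
    rw [Real.norm_eq_abs, abs_mul, abs_of_nonneg (hχnn x), abs_of_nonneg (hF0 x)]
    exact (mul_le_mul (hχle x) (hB x) (hF0 x) zero_le_one).trans (by rw [one_mul])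
  have hD0 : 0 ≤ D := setIntegral_nonneg (measurableSet_zSlab L 0) fun x _ => mul_nonneg (hχnn x) (hF0 x)
  have hV : V ≤ 32 * L * r ^ 2 := by
    have h1 : V = volume.real (S ∩ A) := by
      rw [hVdef, hχ, setIntegral_indicator hAm, setIntegral_const, smul_eq_mul, mul_one]
    rw [h1, measureReal_def]
    refine ENNReal.toReal_le_of_le_ofReal (by positivity) ?_
    calc volume (S ∩ A) ≤ volume (zSlab L 0 ∩ {x | cylRadius x < 2 * r}) :=
          measure_mono fun x hx => ⟨hx.1, hx.2.2⟩
      _ ≤ ENNReal.ofReal (8 * L * (2 * r) ^ 2) := volume_zSlab_inter_cyl_le hL (by linarith)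
      _ = ENNReal.ofReal (32 * L * r ^ 2) := by ring_nf
  have hV0 : 0 ≤ V := setIntegral_nonneg (measurableSet_zSlab L 0) fun x _ => hχnn x
  -- the generic `ε`-bound: `|q| ≤ k χ ε` on `S` ⇒ `|∫_S q| ≤ k ε V ≤ 32 k L r² ε`
  have hsmall : ∀ k : ℝ, 0 ≤ k → ∀ q : EuclideanSpace ℝ (Fin 3) → ℝ, IntegrableOn q S volume →
      (∀ x ∈ S, |q x| ≤ k * (χ x * ε)) → |∫ x in S, q x| ≤ k * ε * (32 * L * r ^ 2) := by
    intro k hk q hqi hqb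
    have h1 := norm_integral_le_of_norm_le (μ := volume.restrict S) ((hχ_int.const_mul (k * ε)))
      ((ae_restrict_iff' (measurableSet_zSlab L 0)).2
        (Eventually.of_forall fun x hx => (?_ : ‖q x‖ ≤ k * ε * χ x)))
    · rw [Real.norm_eq_abs, integral_const_mul] at h1
      exact h1.trans (mul_le_mul_of_nonneg_left hV (by positivity))
    · rw [Real.norm_eq_abs]; exact (hqb x hx).trans (le_of_eq (by ring))
  -- T1: the Green terms (as for rows S6 / S7 (a)(b))
  have hT1 : ∀ i, |∫ x in S, fderiv ℝ φ x (b i) * ⟪fderiv ℝ U x (b i), U x⟫| ≤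
      32 * C * M * L * lam * r + C * M * D / (lam * r) := by
    intro i
    have hdom_int : IntegrableOn
        (fun x => C * M * lam / r * χ x + C * M / (r * lam) * (χ x * F x)) S volume :=
      (hχ_int.const_mul _).add (hD_int.const_mul _)
    have h1 := norm_integral_le_of_norm_le (μ := volume.restrict S) hdom_int
      (Eventually.of_forall fun x => (?_ :
        ‖fderiv ℝ φ x (b i) * ⟪fderiv ℝ U x (b i), U x⟫‖ ≤
          C * M * lam / r * χ x + C * M / (r * lam) * (χ x * F x)))
    · rw [Real.norm_eq_abs] at h1
      have h2 : ∫ x in S, (C * M * lam / r * χ x + C * M / (r * lam) * (χ x * F x)) =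
          C * M * lam / r * V + C * M / (r * lam) * D := by
        rw [integral_add (hχ_int.const_mul _) (hD_int.const_mul _), integral_const_mul,
          integral_const_mul]
      rw [h2] at h1
      have h3 : C * M * lam / r * V ≤ C * M * lam / r * (32 * L * r ^ 2) :=
        mul_le_mul_of_nonneg_left hV (by positivity)
      have e := alg_green C M L D r lam hr0.ne' hlam.ne'
      linarith
    · rw [norm_mul, Real.norm_eq_abs]
      have h2 := hDφi x i
      have h3 : ‖⟪fderiv ℝ U x (b i), U x⟫‖ ≤ ‖fderiv ℝ U x (b i)‖ * M :=
        (norm_inner_le_norm _ _).trans (mul_le_mul_of_nonneg_left (hM x) (norm_nonneg _))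
      have hy : ‖fderiv ℝ U x (b i)‖ ≤ (lam + ‖fderiv ℝ U x (b i)‖ ^ 2 / lam) / 2 := by
        have := young_abs_le ‖fderiv ℝ U x (b i)‖ hlam
        rwa [abs_of_nonneg (norm_nonneg _)] at this
      have hy' : ‖fderiv ℝ U x (b i)‖ ≤ (lam + F x / lam) / 2 :=
        hy.trans (by
          have := div_le_div_of_nonneg_right (hdi x i) hlam.le
          linarith)
      have h5 : 0 ≤ 2 * C / r * χ x := mul_nonneg (by positivity) (hχnn x)
      calc |fderiv ℝ φ x (b i)| * ‖⟪fderiv ℝ U x (b i), U x⟫‖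
          ≤ (2 * C / r * χ x) * (‖fderiv ℝ U x (b i)‖ * M) := mul_le_mul h2 h3 (norm_nonneg _) h5
        _ = (2 * C / r * χ x * M) * ‖fderiv ℝ U x (b i)‖ := by ring
        _ ≤ (2 * C / r * χ x * M) * ((lam + F x / lam) / 2) :=
            mul_le_mul_of_nonneg_left hy' (mul_nonneg h5 hM0)
        _ = C * M * lam / r * χ x + C * M / (r * lam) * (χ x * F x) := by
            field_simp
  have hT1s : |∑ i, ∫ x in S, fderiv ℝ φ x (b i) * ⟪fderiv ℝ U x (b i), U x⟫| ≤
      3 * (32 * C * M * L * lam * r) + 3 * (C * M * D / (lam * r)) := by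
    refine (Finset.abs_sum_le_sum_abs _ _).trans ?_
    calc ∑ i, |∫ x in S, fderiv ℝ φ x (b i) * ⟪fderiv ℝ U x (b i), U x⟫|
        ≤ ∑ _i : Fin 3, (32 * C * M * L * lam * r + C * M * D / (lam * r)) :=
          Finset.sum_le_sum fun i _ => hT1 i
      _ = 3 * (32 * C * M * L * lam * r) + 3 * (C * M * D / (lam * r)) := by simp
  -- T2: the cubic term — here the decay is used
  have hT2_int : IntegrableOn (fun x => fderiv ℝ φ x (U x) * ‖U x‖ ^ 2) S volume :=
    integrableOn_zSlab_of_eq_zero_of_le_cylRadius (Q := fun x => fderiv ℝ φ x (U x) * ‖U x‖ ^ 2)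
      ((hDφc.clm_apply hUc).mul (hUc.norm.pow 2))
      (fun x hx => by show fderiv ℝ φ x (U x) * ‖U x‖ ^ 2 = 0; rw [hDφa x (U x), ha0 x hx, zero_mul, zero_mul]) L 0
  have hT2 : |∫ x in S, fderiv ℝ φ x (U x) * ‖U x‖ ^ 2| ≤ C * M ^ 2 / r ^ 2 * ε * (32 * L * r ^ 2) := by
    refine hsmall (C * M ^ 2 / r ^ 2) (by positivity) _ hT2_int fun x _ => ?_
    rw [hDφa x (U x), abs_mul, abs_mul, abs_of_nonneg (sq_nonneg ‖U x‖)]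
    have h1 := ha x
    have h2 : ‖U x‖ ^ 2 ≤ M ^ 2 := pow_le_pow_left₀ (norm_nonneg _) (hM x) 2
    have h3 := hχur x
    calc |a x| * |ur x| * ‖U x‖ ^ 2 ≤ (C / r ^ 2 * χ x) * |ur x| * M ^ 2 :=
          mul_le_mul (mul_le_mul_of_nonneg_right h1 (abs_nonneg _)) h2 (sq_nonneg _)
            (mul_nonneg (mul_nonneg (by positivity) (hχnn x)) (abs_nonneg _))
      _ = C / r ^ 2 * M ^ 2 * (χ x * |ur x|) := by ring
      _ ≤ C / r ^ 2 * M ^ 2 * (χ x * ε) := mul_le_mul_of_nonneg_left h3 (by positivity)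
      _ = C * M ^ 2 / r ^ 2 * (χ x * ε) := by ring
  -- T3: the pressure term, `u^r = w + ū^r`
  set g : EuclideanSpace ℝ (Fin 3) → EuclideanSpace ℝ (Fin 3) := fun y => ∫ s in (0 : ℝ)..L, U (y + s • eZ)
    with hgdef
  obtain ⟨-, -, -, -, -, hgz, hrepr⟩ := verticalIntegral_props hL hU1 hM hK₁ h.divFree hUper
  have hgz' : ∀ (y : EuclideanSpace ℝ (Fin 3)) (t : ℝ), g (y + t • eZ) = g y := fun y t => hgz y t
  have hrepr' : ∀ y, ⟪horizPart y, g y⟫ = ∫ s in (0 : ℝ)..L, ⟪horizPart y, U (y + s • eZ)⟫ :=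
    fun y => hrepr y
  set w : EuclideanSpace ℝ (Fin 3) → ℝ := fun x => ur x - L⁻¹ * ⟪horizPart x, g x⟫ with hw
  have hgc : Continuous g := by
    have h := intervalIntegral.continuous_parametric_intervalIntegral_of_continuous'
      (μ := volume) (f := fun (y : EuclideanSpace ℝ (Fin 3)) (s : ℝ) => U (y + s • eZ))
      (by exact hUc.comp (continuous_fst.add (continuous_snd.smul continuous_const))) 0 L
    exact h
  have hwc : Continuous w := hurc.sub (continuous_const.mul (horizPart.continuous.inner hgc))
  have hwper : IsAxiallyPeriodic L w := fun x => by
    show ur (x + L • EuclideanSpace.single 2 (1 : ℝ)) - L⁻¹ * ⟪horizPart (x + L • EuclideanSpace.single 2 1),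
      g (x + L • EuclideanSpace.single 2 1)⟫ = ur x - L⁻¹ * ⟪horizPart x, g x⟫
    have e1 : ur (x + L • EuclideanSpace.single 2 (1 : ℝ)) = ur x := radial_periodic hUper x
    have e2 : horizPart (x + L • EuclideanSpace.single 2 (1 : ℝ)) = horizPart x := horizPart_add_smul_eZ x L
    have e3 : g (x + L • EuclideanSpace.single 2 (1 : ℝ)) = g x := hgz' x L
    rw [e1, e2, e3]
  have hwmean : ∀ x, ∫ s in (0 : ℝ)..L, w (x + s • eZ) = 0 := by
    intro x
    have e1 : (fun s : ℝ => w (x + s • eZ)) = fun s : ℝ => ur (x + s • eZ) - L⁻¹ * ⟪horizPart x, g x⟫ := by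
      funext s
      simp only [hw, horizPart_add_smul_eZ, hgz' x s]
    have hi : IntervalIntegrable (fun s : ℝ => ur (x + s • eZ)) volume 0 L :=
      (hurc.comp (continuous_const.add (continuous_id.smul continuous_const))).intervalIntegrable _ _
    rw [e1, intervalIntegral.integral_sub hi intervalIntegrable_const,
      intervalIntegral.integral_const, sub_zero, smul_eq_mul]
    have e2 : ∫ s in (0 : ℝ)..L, ur (x + s • eZ) = ⟪horizPart x, g x⟫ := by
      rw [hrepr' x]
      refine intervalIntegral.integral_congr fun s _ => ?_
      simp only [hur, horizPart_add_smul_eZ]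
    rw [e2]; field_simp; ring
  have hχw : ∀ x, χ x * |w x| ≤ χ x * (2 * ε) := by
    intro x
    by_cases hx : x ∈ A
    · refine mul_le_mul_of_nonneg_left ?_ (hχnn x)
      have h1 : |ur x| ≤ ε := hdec x hx.1
      have h2 : |⟪horizPart x, g x⟫| ≤ L * ε := by
        rw [hrepr' x]
        have h3 := intervalIntegral.norm_integral_le_of_norm_le_const (a := 0) (b := L)
          (f := fun s : ℝ => ⟪horizPart x, U (x + s • eZ)⟫) (C := ε) fun s _ => by
            rw [Real.norm_eq_abs, ← horizPart_add_smul_eZ x s]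
            refine hdec _ ?_
            have : cylRadius (x + s • eZ) = cylRadius x := by simp [cylRadius, eZ]
            rw [this]; exact hx.1
        rw [sub_zero, abs_of_pos hL, Real.norm_eq_abs] at h3
        linarith
      calc |w x| = |ur x - L⁻¹ * ⟪horizPart x, g x⟫| := rfl
        _ ≤ |ur x| + |L⁻¹ * ⟪horizPart x, g x⟫| := abs_sub _ _
        _ ≤ ε + L⁻¹ * (L * ε) := by
            rw [abs_mul, abs_of_pos (inv_pos.2 hL)]
            exact add_le_add h1 (mul_le_mul_of_nonneg_left h2 (inv_pos.2 hL).le)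
        _ = 2 * ε := by field_simp; ring
    · have : χ x = 0 := by simp [hχ, hx]
      rw [this, zero_mul, zero_mul]
  -- the splitting of the pressure integrand
  have hT3a_int : IntegrableOn (fun x => (P x - P (horizPart x)) * (a x * w x)) S volume :=
    integrableOn_zSlab_of_eq_zero_of_le_cylRadius (Q := fun x => (P x - P (horizPart x)) * (a x * w x))
      ((hPc.sub (hPc.comp horizPart.continuous)).mul (hac.mul hwc))
      (fun x hx => by show (P x - P (horizPart x)) * (a x * w x) = 0; rw [ha0 x hx, zero_mul, mul_zero]) L 0
  have hT3b_int : IntegrableOn (fun x => (P (horizPart x) * a x) * w x) S volume :=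
    integrableOn_zSlab_of_eq_zero_of_le_cylRadius (Q := fun x => (P (horizPart x) * a x) * w x)
      (((hPc.comp horizPart.continuous).mul hac).mul hwc)
      (fun x hx => by show (P (horizPart x) * a x) * w x = 0; rw [ha0 x hx, mul_zero, zero_mul]) L 0
  have hT3c_int : IntegrableOn (fun x => L⁻¹ * (P x * (a x * ⟪horizPart x, g x⟫))) S volume :=
    (integrableOn_zSlab_of_eq_zero_of_le_cylRadius (Q := fun x => P x * (a x * ⟪horizPart x, g x⟫))
      (hPc.mul (hac.mul (horizPart.continuous.inner hgc)))
      (fun x hx => by show P x * (a x * ⟪horizPart x, g x⟫) = 0; rw [ha0 x hx, zero_mul, mul_zero]) L 0).const_mul _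
  have hT3eq : ∫ x in S, P x * fderiv ℝ φ x (U x) =
      (∫ x in S, (P x - P (horizPart x)) * (a x * w x)) + (∫ x in S, (P (horizPart x) * a x) * w x) +
        ∫ x in S, L⁻¹ * (P x * (a x * ⟪horizPart x, g x⟫)) := by
    have i12 : IntegrableOn (fun x => (P x - P (horizPart x)) * (a x * w x) + (P (horizPart x) * a x) * w x)
        S volume := hT3a_int.add hT3b_int
    rw [← integral_add hT3a_int hT3b_int, ← integral_add i12 hT3c_int]
    refine setIntegral_congr_fun (measurableSet_zSlab L 0) fun x _ => ?_
    simp only [hw, hur, hDφa x (U x)]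
    field_simp
    ring
  have hT3b : ∫ x in S, (P (horizPart x) * a x) * w x = 0 := by
    obtain ⟨A₀, hA₀⟩ := (isCompact_closedBall (0 : EuclideanSpace ℝ (Fin 3)) (2 * r)).exists_bound_of_continuousOn
      hac.continuousOn
    obtain ⟨P₀, hP₀⟩ := (isCompact_closedBall (0 : EuclideanSpace ℝ (Fin 3)) (2 * r)).exists_bound_of_continuousOn
      hPc.continuousOn
    have hA₀0 : 0 ≤ A₀ := (norm_nonneg _).trans (hA₀ 0 (Metric.mem_closedBall_self (by linarith)))
    have hgm : Measurable fun x => P (horizPart x) * a x := ((hPc.comp horizPart.continuous).mul hac).measurable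
    have hgz' : ∀ (x : EuclideanSpace ℝ (Fin 3)) (s : ℝ),
        P (horizPart (x + s • eZ)) * a (x + s • eZ) = P (horizPart x) * a x := fun x s => by
      rw [horizPart_add_smul_eZ, haz]
    have hgG : ∀ x, |P (horizPart x) * a x| ≤ P₀ * A₀ := by
      intro x
      by_cases hx : 2 * r ≤ cylRadius x
      · rw [ha0 x hx, mul_zero, abs_zero]; exact mul_nonneg ((norm_nonneg _).trans (hP₀ 0
          (Metric.mem_closedBall_self (by linarith)))) hA₀0
      · rw [not_le] at hx
        have hmem : horizPart x ∈ Metric.closedBall (0 : EuclideanSpace ℝ (Fin 3)) (2 * r) := by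
          rw [mem_closedBall_zero_iff, norm_horizPart]; exact hx.le
        have hax : a x = a (horizPart x) := by
          conv_lhs => rw [← horizPart_add_apply_two_smul_eZ x]
          exact haz _ _
        rw [abs_mul, hax, ← Real.norm_eq_abs, ← Real.norm_eq_abs]
        exact mul_le_mul (hP₀ _ hmem) (hA₀ _ hmem) (norm_nonneg _)
          ((norm_nonneg _).trans (hP₀ _ hmem))
    have hgρ : ∀ x, 2 * r ≤ cylRadius x → P (horizPart x) * a x = 0 := fun x hx => by
      rw [ha0 x hx, mul_zero]
    exact setIntegral_zSlab_mul_eq_zero_of_verticalMean hL hgm hgz' hgG hgρ hwc hwper hwmean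
  have hT3a : |∫ x in S, (P x - P (horizPart x)) * (a x * w x)| ≤ K₃ * L * C / r ^ 2 * 2 * ε * (32 * L * r ^ 2) := by
    refine hsmall (K₃ * L * C / r ^ 2 * 2) (by positivity) _ hT3a_int fun x hx => ?_
    rw [abs_mul, abs_mul]
    have h1 : |P x - P (horizPart x)| ≤ K₃ * L := abs_sub_footPressure_le hPd hK₃ hx
    have h2 := ha x
    have h3 := hχw x
    calc |P x - P (horizPart x)| * (|a x| * |w x|) ≤ (K₃ * L) * (C / r ^ 2 * χ x * |w x|) := by
          refine mul_le_mul h1 (mul_le_mul_of_nonneg_right h2 (abs_nonneg _)) (by positivity) (by positivity)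
      _ = K₃ * L * C / r ^ 2 * (χ x * |w x|) := by ring
      _ ≤ K₃ * L * C / r ^ 2 * (χ x * (2 * ε)) := mul_le_mul_of_nonneg_left h3 (by positivity)
      _ = K₃ * L * C / r ^ 2 * 2 * (χ x * ε) := by ring
  have hT3c : |∫ x in S, L⁻¹ * (P x * (a x * ⟪horizPart x, g x⟫))| ≤
      (48 * C * L * (3 * M + Real.pi) + 16 * C * L * M * (Real.pi + M)) * lam * r +
        (3 / 2 * C * (3 * M + Real.pi) + 1 / 2 * C * M * (Real.pi + M)) * D / (lam * r) := by
    have hcore := corrector_pressure_bound hL h hU hP hUper hPper hM hK₁ hB hC0 hW hDW hr hlam hε1 hdec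
    rw [integral_const_mul, abs_mul, abs_of_pos (inv_pos.2 hL)]
    rw [inv_mul_le_iff₀ hL]
    exact hcore
  -- assemble
  have hmain : Iφ = -(∑ i, ∫ x in S, fderiv ℝ φ x (b i) * ⟪fderiv ℝ U x (b i), U x⟫) +
      2⁻¹ * (∫ x in S, fderiv ℝ φ x (U x) * ‖U x‖ ^ 2) +
      ∫ x in S, P x * fderiv ℝ φ x (U x) := hid
  rw [hT3eq, hT3b, add_zero] at hmain
  have a1 := (abs_le.1 hT1s).1
  have a2 := (abs_le.1 hT2).2
  have a3 := (abs_le.1 hT3a).2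
  have a4 := (abs_le.1 hT3c).2
  have e2 : C * M ^ 2 / r ^ 2 * ε * (32 * L * r ^ 2) = 32 * C * M ^ 2 * L * ε := by field_simp
  have e3 : K₃ * L * C / r ^ 2 * 2 * ε * (32 * L * r ^ 2) = 64 * C * K₃ * L ^ 2 * ε := by
    field_simp; ring
  rw [e2] at a2
  rw [e3] at a3
  have hfin : Iφ ≤ 3 * (32 * C * M * L * lam * r) + 3 * (C * M * D / (lam * r)) +
      2⁻¹ * (32 * C * M ^ 2 * L * ε) + 64 * C * K₃ * L ^ 2 * ε +
      ((48 * C * L * (3 * M + Real.pi) + 16 * C * L * M * (Real.pi + M)) * lam * r +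
        (3 / 2 * C * (3 * M + Real.pi) + 1 / 2 * C * M * (Real.pi + M)) * D / (lam * r)) := by
    rw [hmain]; linarith
  have e : 3 * (32 * C * M * L * lam * r) + 3 * (C * M * D / (lam * r)) +
      2⁻¹ * (32 * C * M ^ 2 * L * ε) + 64 * C * K₃ * L ^ 2 * ε +
      ((48 * C * L * (3 * M + Real.pi) + 16 * C * L * M * (Real.pi + M)) * lam * r +
        (3 / 2 * C * (3 * M + Real.pi) + 1 / 2 * C * M * (Real.pi + M)) * D / (lam * r)) =
      (16 * C * M ^ 2 * L + 64 * C * K₃ * L ^ 2) * ε +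
        (96 * C * M * L + 48 * C * L * (3 * M + Real.pi) + 16 * C * L * M * (Real.pi + M)) * lam * r +
        (3 * C * M + 3 / 2 * C * (3 * M + Real.pi) + 1 / 2 * C * M * (Real.pi + M)) * D / (lam * r) := by
    ring
  rw [← e]
  exact hfin

end Summit.NavierStokesRegularity.NavierStokesRegularity.Theorems.ScenarioCensus.PeriodicSlab

end
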